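import Mathlib.Analysis.Complex.Exponential
import Mathlib.Algebra.Order.BigOperators.Group.Finset
import Mathlib.Algebra.BigOperators.Field

/-!
# DAG node N14 (NE1′) → N19′ ∕ N20 — TILTING TWO CLASS LAWS: per-set total variation under bounded re-weighting (pure finite sums; the
# arithmetic half of «dressing the class-law TV letter costs only N14's binder»)

Cell `pub-ymgap` (HUMAN RULING D-0062, Track A), WIDTH SEAT `pub-ymgap-dag-n14-w2` (NODE n14 = NE1′), generation 6, FILE 2a; `--kind proof --supports
stmt-QuantumFields-20544 --as helper` (K3⁷; helper, NOT a discharge; count-neutral).  THEOREMS ONLY (0 `def`, 0 `instance`, 0 `sorry`); imports Mathlib ONLY.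
Split from the announced `…N14ClassLawTVDressingTransfer` under the 400-line rule: this file is its §1 (finite sums), the sibling FILE 2b
`…N14ClassLawTVDressingTransfer` instantiates it at NE1′'s MGF forms (`A K t τ = A K 0 τ·e^{cgf_τ(t) − cgf_τ(0)}`) and feeds FILE 1 (`…N14TargetOfBinderAndClassLawTV`).

CONTENT [folklore].  One finite class set `T`, base weights `a, b ≥ 0` with positive totals (class laws `a∕Σa`, `b∕Σb`), TILT FACTORS `w, w′` with values in `[M⁻¹, M]`
(`1 ≤ M`; in FILE 2b `M = e^{l₀B}` from node E2's MGF bounds), a bad class `Bad ⊆ T` of base weight `Σ_Bad a ≤ W·Σ_T a`, and dag-n20-w4's PER-SET total-variation letter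
`|Σ_S a∕Σ_T a − Σ_S b∕Σ_T b| ≤ ρ` (`S ⊆ T`).  Then:
* `abs_sum_sub_mul_le_of_forall_subset` — a test function with values in `[0, M]` is read within `M·ρ` by the two laws (sign split; no ℓ¹ detour);
* ★ `abs_tilted_sub_tilted_le_base` — SAME tilt, two base laws: the `w`-tilted laws `a·w∕Σa·w`, `b·w∕Σb·w` are at per-set distance `≤ 2M²·ρ`;
* ★ `abs_tilted_sub_tilted_le_tilt` — SAME base law, two tilts with `|w′ − w| ≤ κ·w` off `Bad`: per-set distance `≤ 2κ + 2M²·W`;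
* ★★ `abs_tilted_sub_tilted_le` — both at once: `≤ 2M²·(ρ + W) + 2κ`; `tilted_bad_le` (`Σ_Bad a·w ≤ M²·W·Σ_T a·w`), `tilted_total_pos`, the ratio lemma
  `abs_div_sub_div_le_two_mul_div`, `tilted_ratio_eq`, `inv_le_sum_div_mul`.

HONEST FRAMING.  [folklore] finite-sum inequalities on hypothesis SHAPES; nothing of Bałaban's asserted or instantiated; no estimate of the programme is proved; NE1′ ∕ NE7 ∕
NE7b NOT PRINTED as two-run statements for d = 4, NOT proved; N14 ∕ N19 ∕ N20 NOT discharged; K3⁷ OPEN, skeleton v5 untouched; counts UNMOVED.  One finite 𝕋⁴ programme at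
fixed ε; R4 closes only the CONDITIONAL finite-𝕋⁴ rung `BalabanLadder.UV` — NOT ℝ⁴, NOT OS, NOT the Yang–Mills mass gap (Clay), which is NOT proved by any of this.
-/

noncomputable section

open Finset

namespace YMDAG.N14.ClassLawTiltTransfer

/-! ## §1 One class law re-weighted by bounded tilt factors -/

section FiniteSums

variable {ι : Type*} {T Bad S : Finset ι} {a b w w' f : ι → ℝ} {M ρ κ W : ℝ}

/-- Two ratios with close numerators and denominators: `0 < Y`, `0 < Y′`, `0 ≤ X′ ≤ Y′`, `|X − X′| ≤ e`, `|Y − Y′| ≤ e` ⇒ `|X∕Y − X′∕Y′| ≤ 2e∕Y`. [folklore] -/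
theorem abs_div_sub_div_le_two_mul_div {X Y X' Y' e : ℝ} (hY : 0 < Y) (hY' : 0 < Y') (hX' : 0 ≤ X') (hX'Y' : X' ≤ Y')
    (hX : |X - X'| ≤ e) (hYY : |Y - Y'| ≤ e) : |X / Y - X' / Y'| ≤ 2 * e / Y := by
  have hq : X' / Y' ≤ 1 := (div_le_one hY').mpr hX'Y'
  have hq0 : 0 ≤ X' / Y' := div_nonneg hX' hY'.le
  have hsplit : X / Y - X' / Y' = (X - X') / Y + (X' / Y') * ((Y' - Y) / Y) := by
    field_simp
    ring
  rw [hsplit]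
  calc |(X - X') / Y + X' / Y' * ((Y' - Y) / Y)| ≤ |(X - X') / Y| + |X' / Y' * ((Y' - Y) / Y)| := abs_add_le _ _
    _ = |X - X'| / Y + X' / Y' * (|Y' - Y| / Y) := by
        rw [abs_div, abs_of_pos hY, abs_mul, abs_of_nonneg hq0, abs_div, abs_of_pos hY]
    _ ≤ e / Y + 1 * (e / Y) := by
        gcongr
        rw [abs_sub_comm]; exact hYY
    _ = 2 * e / Y := by ring

/-- A test function with values in `[0, M]` on `S ⊆ T` is read within `M·ρ` by two class laws `a∕Σ_T a`, `b∕Σ_T b` at per-set TV distance `ρ`: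
`|Σ_S (a∕Σa − b∕Σb)·f| ≤ M·ρ` (split `S` at the sign of `a∕Σa − b∕Σb`). [folklore] -/
theorem abs_sum_sub_mul_le_of_forall_subset (hS : S ⊆ T) (hM : 0 ≤ M) (hf0 : ∀ τ ∈ S, 0 ≤ f τ) (hfM : ∀ τ ∈ S, f τ ≤ M)
    (hρ : ∀ S' ⊆ T, |(∑ τ ∈ S', a τ) / (∑ τ ∈ T, a τ) - (∑ τ ∈ S', b τ) / (∑ τ ∈ T, b τ)| ≤ ρ) :
    |∑ τ ∈ S, (a τ / (∑ σ ∈ T, a σ) - b τ / (∑ σ ∈ T, b σ)) * f τ| ≤ M * ρ := by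
  set d : ι → ℝ := fun τ => a τ / (∑ σ ∈ T, a σ) - b τ / (∑ σ ∈ T, b σ) with hd
  have hdsum : ∀ S' ⊆ T, |∑ τ ∈ S', d τ| ≤ ρ := fun S' hS' => by
    have h := hρ S' hS'
    rwa [Finset.sum_div, Finset.sum_div, ← Finset.sum_sub_distrib] at h
  set Sp := S.filter fun τ => 0 < d τ
  set Sn := S.filter fun τ => ¬ 0 < d τ
  have hSp : Sp ⊆ T := (Finset.filter_subset _ _).trans hS
  have hSn : Sn ⊆ T := (Finset.filter_subset _ _).trans hS
  have hsplit : ∑ τ ∈ S, d τ * f τ = ∑ τ ∈ Sp, d τ * f τ + ∑ τ ∈ Sn, d τ * f τ :=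
    (Finset.sum_filter_add_sum_filter_not S (fun τ => 0 < d τ) _).symm
  -- positive part: `0 ≤ Σ_{Sp} d·f ≤ M·Σ_{Sp} d ≤ M·ρ`; negative part: `−M·ρ ≤ M·Σ_{Sn} d ≤ Σ_{Sn} d·f ≤ 0`
  have hp_hi : ∑ τ ∈ Sp, d τ * f τ ≤ M * ρ :=
    calc ∑ τ ∈ Sp, d τ * f τ ≤ ∑ τ ∈ Sp, d τ * M := Finset.sum_le_sum fun τ hτ =>
            mul_le_mul_of_nonneg_left (hfM τ (Finset.mem_of_mem_filter τ hτ)) (le_of_lt (Finset.mem_filter.mp hτ).2)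
      _ = M * ∑ τ ∈ Sp, d τ := by rw [← Finset.sum_mul, mul_comm]
      _ ≤ M * ρ := mul_le_mul_of_nonneg_left ((le_abs_self _).trans (hdsum Sp hSp)) hM
  have hp_lo : 0 ≤ ∑ τ ∈ Sp, d τ * f τ := Finset.sum_nonneg fun τ hτ =>
    mul_nonneg (le_of_lt (Finset.mem_filter.mp hτ).2) (hf0 τ (Finset.mem_of_mem_filter τ hτ))
  have hn_lo : -(M * ρ) ≤ ∑ τ ∈ Sn, d τ * f τ :=
    calc -(M * ρ) ≤ M * ∑ τ ∈ Sn, d τ := by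
            rw [← mul_neg]; exact mul_le_mul_of_nonneg_left ((neg_abs_le _).trans' (neg_le_neg (hdsum Sn hSn))) hM
      _ = ∑ τ ∈ Sn, d τ * M := by rw [← Finset.sum_mul, mul_comm]
      _ ≤ ∑ τ ∈ Sn, d τ * f τ := Finset.sum_le_sum fun τ hτ =>
            mul_le_mul_of_nonpos_left (hfM τ (Finset.mem_of_mem_filter τ hτ)) (le_of_not_gt (Finset.mem_filter.mp hτ).2)
  have hn_hi : ∑ τ ∈ Sn, d τ * f τ ≤ 0 := Finset.sum_nonpos fun τ hτ =>
    mul_nonpos_of_nonpos_of_nonneg (le_of_not_gt (Finset.mem_filter.mp hτ).2) (hf0 τ (Finset.mem_of_mem_filter τ hτ))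
  rw [hsplit, abs_le]
  constructor <;> linarith

/-- Rescaling numerator and denominator by the positive base total: `Σ_S a·w ∕ Σ_T a·w = (Σ_S (a∕Σ_T a)·w) ∕ (Σ_T (a∕Σ_T a)·w)`. [folklore] -/
theorem tilted_ratio_eq (hZa : 0 < ∑ τ ∈ T, a τ) (S : Finset ι) :
    (∑ τ ∈ S, a τ * w τ) / (∑ τ ∈ T, a τ * w τ)
      = (∑ τ ∈ S, a τ / (∑ σ ∈ T, a σ) * w τ) / (∑ τ ∈ T, a τ / (∑ σ ∈ T, a σ) * w τ) := by
  have h : ∀ S' : Finset ι, ∑ τ ∈ S', a τ / (∑ σ ∈ T, a σ) * w τ = (∑ τ ∈ S', a τ * w τ) / ∑ σ ∈ T, a σ := fun S' => by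
    rw [Finset.sum_div]; exact Finset.sum_congr rfl fun τ _ => by ring
  rw [h, h, div_div_div_cancel_right₀ hZa.ne']

/-- The normalised tilted total is at least `M⁻¹` when `M⁻¹ ≤ w`: `M⁻¹ ≤ Σ_T (a∕Σ_T a)·w`. [folklore] -/
theorem inv_le_sum_div_mul (ha : ∀ τ ∈ T, 0 ≤ a τ) (hZa : 0 < ∑ τ ∈ T, a τ) (hwlo : ∀ τ ∈ T, M⁻¹ ≤ w τ) :
    M⁻¹ ≤ ∑ τ ∈ T, a τ / (∑ σ ∈ T, a σ) * w τ :=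
  calc M⁻¹ = ∑ τ ∈ T, a τ / (∑ σ ∈ T, a σ) * M⁻¹ := by rw [← Finset.sum_mul, ← Finset.sum_div, div_self hZa.ne', one_mul]
    _ ≤ ∑ τ ∈ T, a τ / (∑ σ ∈ T, a σ) * w τ :=
        Finset.sum_le_sum fun τ hτ => mul_le_mul_of_nonneg_left (hwlo τ hτ) (div_nonneg (ha τ hτ) hZa.le)

/-- ★ **SAME TILT, TWO BASE LAWS.**  Tilt factors `M⁻¹ ≤ w ≤ M` (`1 ≤ M`); two class laws `a∕Σa`, `b∕Σb` (`a, b ≥ 0`, positive totals) at per-set TV distance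
`ρ` on `T`.  Then the `w`-tilted laws are at per-set distance `≤ 2M²·ρ`: `|Σ_S a·w ∕ Σ_T a·w − Σ_S b·w ∕ Σ_T b·w| ≤ 2M²·ρ`, `S ⊆ T`. [folklore] -/
theorem abs_tilted_sub_tilted_le_base (hM : 1 ≤ M) (ha : ∀ τ ∈ T, 0 ≤ a τ) (hb : ∀ τ ∈ T, 0 ≤ b τ) (hZa : 0 < ∑ τ ∈ T, a τ)
    (hZb : 0 < ∑ τ ∈ T, b τ) (hwlo : ∀ τ ∈ T, M⁻¹ ≤ w τ) (hwhi : ∀ τ ∈ T, w τ ≤ M)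
    (hρ : ∀ S' ⊆ T, |(∑ τ ∈ S', a τ) / (∑ τ ∈ T, a τ) - (∑ τ ∈ S', b τ) / (∑ τ ∈ T, b τ)| ≤ ρ) (hS : S ⊆ T) :
    |(∑ τ ∈ S, a τ * w τ) / (∑ τ ∈ T, a τ * w τ) - (∑ τ ∈ S, b τ * w τ) / (∑ τ ∈ T, b τ * w τ)| ≤ 2 * M ^ 2 * ρ := by
  have hM0 : 0 < M := one_pos.trans_le hM
  have hw0 : ∀ τ ∈ T, 0 ≤ w τ := fun τ hτ => (inv_pos.mpr hM0).le.trans (hwlo τ hτ)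
  rw [tilted_ratio_eq hZa, tilted_ratio_eq hZb]
  set p : ι → ℝ := fun τ => a τ / ∑ σ ∈ T, a σ
  set q : ι → ℝ := fun τ => b τ / ∑ σ ∈ T, b σ
  have hq0 : ∀ τ ∈ T, 0 ≤ q τ := fun τ hτ => div_nonneg (hb τ hτ) hZb.le
  have hY : M⁻¹ ≤ ∑ τ ∈ T, p τ * w τ := inv_le_sum_div_mul ha hZa hwlo
  have hY' : M⁻¹ ≤ ∑ τ ∈ T, q τ * w τ := inv_le_sum_div_mul hb hZb hwlo
  have hMi : 0 < M⁻¹ := inv_pos.mpr hM0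
  -- numerators and denominators differ by at most `M·ρ`
  have hnum : |∑ τ ∈ S, p τ * w τ - ∑ τ ∈ S, q τ * w τ| ≤ M * ρ := by
    rw [← Finset.sum_sub_distrib]
    simpa only [sub_mul] using abs_sum_sub_mul_le_of_forall_subset (a := a) (b := b) hS hM0.le
      (fun τ hτ => hw0 τ (hS hτ)) (fun τ hτ => hwhi τ (hS hτ)) hρ
  have hden : |∑ τ ∈ T, p τ * w τ - ∑ τ ∈ T, q τ * w τ| ≤ M * ρ := by
    rw [← Finset.sum_sub_distrib]
    simpa only [sub_mul] using abs_sum_sub_mul_le_of_forall_subset (a := a) (b := b) (Finset.Subset.refl T) hM0.le hw0 hwhi hρ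
  have hX' : 0 ≤ ∑ τ ∈ S, q τ * w τ := Finset.sum_nonneg fun τ hτ => mul_nonneg (hq0 τ (hS hτ)) (hw0 τ (hS hτ))
  have hX'Y' : ∑ τ ∈ S, q τ * w τ ≤ ∑ τ ∈ T, q τ * w τ :=
    Finset.sum_le_sum_of_subset_of_nonneg hS fun τ hτ _ => mul_nonneg (hq0 τ hτ) (hw0 τ hτ)
  calc |(∑ τ ∈ S, p τ * w τ) / (∑ τ ∈ T, p τ * w τ) - (∑ τ ∈ S, q τ * w τ) / (∑ τ ∈ T, q τ * w τ)|
      ≤ 2 * (M * ρ) / ∑ τ ∈ T, p τ * w τ :=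
        abs_div_sub_div_le_two_mul_div (hMi.trans_le hY) (hMi.trans_le hY') hX' hX'Y' hnum hden
    _ ≤ 2 * (M * ρ) / M⁻¹ := by
        have hρ0 : 0 ≤ ρ := (abs_nonneg _).trans (hρ ∅ (Finset.empty_subset _))
        exact div_le_div_of_nonneg_left (by positivity) hMi hY
    _ = 2 * M ^ 2 * ρ := by rw [div_inv_eq_mul]; ring

/-- The bad class under the TILTED law: `Σ_Bad a·w ≤ M²·W·Σ_T a·w`. [folklore] -/
theorem tilted_bad_le (hM : 1 ≤ M) (ha : ∀ τ ∈ T, 0 ≤ a τ) (hZa : 0 < ∑ τ ∈ T, a τ) (hBad : Bad ⊆ T)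
    (hW : ∑ τ ∈ Bad, a τ ≤ W * ∑ τ ∈ T, a τ) (hwlo : ∀ τ ∈ T, M⁻¹ ≤ w τ) (hwhi : ∀ τ ∈ T, w τ ≤ M) :
    ∑ τ ∈ Bad, a τ * w τ ≤ M ^ 2 * W * ∑ τ ∈ T, a τ * w τ := by
  have hM0 : 0 < M := one_pos.trans_le hM
  have hW0 : 0 ≤ W := (mul_nonneg_iff_of_pos_right hZa).mp ((Finset.sum_nonneg fun τ hτ => ha τ (hBad hτ)).trans hW)
  have h1 : ∑ τ ∈ Bad, a τ * w τ ≤ M * (W * ∑ τ ∈ T, a τ) :=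
    calc ∑ τ ∈ Bad, a τ * w τ ≤ ∑ τ ∈ Bad, a τ * M :=
          Finset.sum_le_sum fun τ hτ => mul_le_mul_of_nonneg_left (hwhi τ (hBad hτ)) (ha τ (hBad hτ))
      _ = (∑ τ ∈ Bad, a τ) * M := by rw [Finset.sum_mul]
      _ ≤ (W * ∑ τ ∈ T, a τ) * M := mul_le_mul_of_nonneg_right hW hM0.le
      _ = M * (W * ∑ τ ∈ T, a τ) := by ring
  have h2 : ∑ τ ∈ T, a τ ≤ M * ∑ τ ∈ T, a τ * w τ :=
    calc ∑ τ ∈ T, a τ = M * ∑ τ ∈ T, a τ * M⁻¹ := by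
          rw [Finset.mul_sum]; exact Finset.sum_congr rfl fun τ _ => by field_simp
      _ ≤ M * ∑ τ ∈ T, a τ * w τ := mul_le_mul_of_nonneg_left
          (Finset.sum_le_sum fun τ hτ => mul_le_mul_of_nonneg_left (hwlo τ hτ) (ha τ hτ)) hM0.le
  calc ∑ τ ∈ Bad, a τ * w τ ≤ M * (W * ∑ τ ∈ T, a τ) := h1
    _ ≤ M * (W * (M * ∑ τ ∈ T, a τ * w τ)) := by gcongr
    _ = M ^ 2 * W * ∑ τ ∈ T, a τ * w τ := by ring

/-- The tilted total is positive: `0 < Σ_T a·w` (base total positive, `M⁻¹ ≤ w`, `1 ≤ M`). [folklore] -/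
theorem tilted_total_pos (hM : 1 ≤ M) (ha : ∀ τ ∈ T, 0 ≤ a τ) (hZa : 0 < ∑ τ ∈ T, a τ) (hwlo : ∀ τ ∈ T, M⁻¹ ≤ w τ) :
    0 < ∑ τ ∈ T, a τ * w τ := by
  have hMi : 0 < M⁻¹ := inv_pos.mpr (one_pos.trans_le hM)
  calc (0 : ℝ) < (∑ τ ∈ T, a τ) * M⁻¹ := mul_pos hZa hMi
    _ = ∑ τ ∈ T, a τ * M⁻¹ := by rw [Finset.sum_mul]
    _ ≤ ∑ τ ∈ T, a τ * w τ := Finset.sum_le_sum fun τ hτ => mul_le_mul_of_nonneg_left (hwlo τ hτ) (ha τ hτ)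

variable [DecidableEq ι]

/-- ★ **SAME BASE LAW, TWO TILTS.**  Tilt factors `M⁻¹ ≤ w, w′ ≤ M` (`1 ≤ M`) that agree RELATIVELY off a bad class, `|w′ − w| ≤ κ·w` on `T ∖ Bad`, the bad class
carrying base weight `Σ_Bad a ≤ W·Σ_T a` (`a ≥ 0`, positive total).  Then `|Σ_S a·w ∕ Σ_T a·w − Σ_S a·w′ ∕ Σ_T a·w′| ≤ 2κ + 2M²·W`, `S ⊆ T`. [folklore] -/
theorem abs_tilted_sub_tilted_le_tilt (hM : 1 ≤ M) (ha : ∀ τ ∈ T, 0 ≤ a τ) (hZa : 0 < ∑ τ ∈ T, a τ) (hBad : Bad ⊆ T)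
    (hW : ∑ τ ∈ Bad, a τ ≤ W * ∑ τ ∈ T, a τ) (hwlo : ∀ τ ∈ T, M⁻¹ ≤ w τ) (hwhi : ∀ τ ∈ T, w τ ≤ M)
    (hwlo' : ∀ τ ∈ T, M⁻¹ ≤ w' τ) (hwhi' : ∀ τ ∈ T, w' τ ≤ M) (hκ : 0 ≤ κ) (hgood : ∀ τ ∈ T \ Bad, |w' τ - w τ| ≤ κ * w τ)
    (hS : S ⊆ T) :
    |(∑ τ ∈ S, a τ * w τ) / (∑ τ ∈ T, a τ * w τ) - (∑ τ ∈ S, a τ * w' τ) / (∑ τ ∈ T, a τ * w' τ)| ≤ 2 * κ + 2 * M ^ 2 * W := by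
  have hM0 : 0 < M := one_pos.trans_le hM
  have hMi : 0 < M⁻¹ := inv_pos.mpr hM0
  have hw0 : ∀ τ ∈ T, 0 ≤ w τ := fun τ hτ => hMi.le.trans (hwlo τ hτ)
  have hw0' : ∀ τ ∈ T, 0 ≤ w' τ := fun τ hτ => hMi.le.trans (hwlo' τ hτ)
  rw [tilted_ratio_eq hZa, tilted_ratio_eq hZa]
  set p : ι → ℝ := fun τ => a τ / ∑ σ ∈ T, a σ
  have hp0 : ∀ τ ∈ T, 0 ≤ p τ := fun τ hτ => div_nonneg (ha τ hτ) hZa.le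
  have hp1 : ∑ τ ∈ T, p τ = 1 := by
    show ∑ τ ∈ T, a τ / ∑ σ ∈ T, a σ = 1; rw [← Finset.sum_div, div_self hZa.ne']
  have hpBad : ∑ τ ∈ Bad, p τ ≤ W := by
    show ∑ τ ∈ Bad, a τ / ∑ σ ∈ T, a σ ≤ W; rw [← Finset.sum_div, div_le_iff₀ hZa]; exact hW
  set Y := ∑ τ ∈ T, p τ * w τ
  have hY : M⁻¹ ≤ Y := inv_le_sum_div_mul ha hZa hwlo
  have hYpos : 0 < Y := hMi.trans_le hY
  -- the common error `e = Σ_T p·|w − w′| ≤ κ·Y + M·W`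
  have he : ∑ τ ∈ T, p τ * |w τ - w' τ| ≤ κ * Y + M * W := by
    rw [← Finset.sum_sdiff hBad]
    have hgood' : ∑ τ ∈ T \ Bad, p τ * |w τ - w' τ| ≤ κ * Y :=
      calc ∑ τ ∈ T \ Bad, p τ * |w τ - w' τ| ≤ ∑ τ ∈ T \ Bad, p τ * (κ * w τ) := Finset.sum_le_sum fun τ hτ => by
              rw [abs_sub_comm]; exact mul_le_mul_of_nonneg_left (hgood τ hτ) (hp0 τ (Finset.sdiff_subset hτ))
        _ ≤ ∑ τ ∈ T, p τ * (κ * w τ) := Finset.sum_le_sum_of_subset_of_nonneg Finset.sdiff_subset fun τ hτ _ =>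
              mul_nonneg (hp0 τ hτ) (mul_nonneg hκ (hw0 τ hτ))
        _ = κ * Y := by rw [Finset.mul_sum]; exact Finset.sum_congr rfl fun τ _ => by ring
    have hbad' : ∑ τ ∈ Bad, p τ * |w τ - w' τ| ≤ M * W :=
      calc ∑ τ ∈ Bad, p τ * |w τ - w' τ| ≤ ∑ τ ∈ Bad, p τ * M := Finset.sum_le_sum fun τ hτ => by
              refine mul_le_mul_of_nonneg_left (abs_sub_le_iff.mpr ⟨?_, ?_⟩) (hp0 τ (hBad hτ))
              · linarith [hwhi τ (hBad hτ), hw0' τ (hBad hτ)]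
              · linarith [hwhi' τ (hBad hτ), hw0 τ (hBad hτ)]
        _ = (∑ τ ∈ Bad, p τ) * M := by rw [Finset.sum_mul]
        _ ≤ W * M := mul_le_mul_of_nonneg_right hpBad hM0.le
        _ = M * W := mul_comm _ _
    exact add_le_add hgood' hbad'
  have habs : ∀ S' ⊆ T, |∑ τ ∈ S', p τ * w τ - ∑ τ ∈ S', p τ * w' τ| ≤ κ * Y + M * W := fun S' hS' =>
    calc |∑ τ ∈ S', p τ * w τ - ∑ τ ∈ S', p τ * w' τ| = |∑ τ ∈ S', p τ * (w τ - w' τ)| := by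
            rw [← Finset.sum_sub_distrib]; exact congrArg _ (Finset.sum_congr rfl fun τ _ => by ring)
      _ ≤ ∑ τ ∈ S', |p τ * (w τ - w' τ)| := Finset.abs_sum_le_sum_abs _ _
      _ = ∑ τ ∈ S', p τ * |w τ - w' τ| := Finset.sum_congr rfl fun τ hτ => by rw [abs_mul, abs_of_nonneg (hp0 τ (hS' hτ))]
      _ ≤ ∑ τ ∈ T, p τ * |w τ - w' τ| := Finset.sum_le_sum_of_subset_of_nonneg hS' fun τ hτ _ => mul_nonneg (hp0 τ hτ) (abs_nonneg _)
      _ ≤ κ * Y + M * W := he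
  have hX' : 0 ≤ ∑ τ ∈ S, p τ * w' τ := Finset.sum_nonneg fun τ hτ => mul_nonneg (hp0 τ (hS hτ)) (hw0' τ (hS hτ))
  have hX'Y' : ∑ τ ∈ S, p τ * w' τ ≤ ∑ τ ∈ T, p τ * w' τ :=
    Finset.sum_le_sum_of_subset_of_nonneg hS fun τ hτ _ => mul_nonneg (hp0 τ hτ) (hw0' τ hτ)
  have hY' : 0 < ∑ τ ∈ T, p τ * w' τ := hMi.trans_le (inv_le_sum_div_mul ha hZa hwlo')
  have hW0 : 0 ≤ W := le_trans (Finset.sum_nonneg fun τ hτ => hp0 τ (hBad hτ)) hpBad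
  calc |(∑ τ ∈ S, p τ * w τ) / Y - (∑ τ ∈ S, p τ * w' τ) / (∑ τ ∈ T, p τ * w' τ)|
      ≤ 2 * (κ * Y + M * W) / Y := abs_div_sub_div_le_two_mul_div hYpos hY' hX' hX'Y' (habs S hS) (habs T (Finset.Subset.refl T))
    _ = 2 * κ + 2 * (M * W) / Y := by rw [mul_add, add_div, ← mul_assoc, mul_div_cancel_right₀ _ hYpos.ne']
    _ ≤ 2 * κ + 2 * (M * W) / M⁻¹ := by gcongr
    _ = 2 * κ + 2 * M ^ 2 * W := by rw [div_inv_eq_mul]; ring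

/-- ★★ **BOTH AT ONCE**: two base laws at per-set TV distance `ρ`, two tilts in `[M⁻¹, M]` agreeing relatively within `κ` off the bad class of base weight `W` ⇒ the
tilted laws are at per-set TV distance `≤ 2M²·(ρ + W) + 2κ`. [folklore] -/
theorem abs_tilted_sub_tilted_le (hM : 1 ≤ M) (ha : ∀ τ ∈ T, 0 ≤ a τ) (hb : ∀ τ ∈ T, 0 ≤ b τ) (hZa : 0 < ∑ τ ∈ T, a τ)
    (hZb : 0 < ∑ τ ∈ T, b τ) (hBad : Bad ⊆ T) (hW : ∑ τ ∈ Bad, a τ ≤ W * ∑ τ ∈ T, a τ) (hwlo : ∀ τ ∈ T, M⁻¹ ≤ w τ)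
    (hwhi : ∀ τ ∈ T, w τ ≤ M) (hwlo' : ∀ τ ∈ T, M⁻¹ ≤ w' τ) (hwhi' : ∀ τ ∈ T, w' τ ≤ M) (hκ : 0 ≤ κ)
    (hgood : ∀ τ ∈ T \ Bad, |w' τ - w τ| ≤ κ * w τ)
    (hρ : ∀ S' ⊆ T, |(∑ τ ∈ S', a τ) / (∑ τ ∈ T, a τ) - (∑ τ ∈ S', b τ) / (∑ τ ∈ T, b τ)| ≤ ρ) (hS : S ⊆ T) :
    |(∑ τ ∈ S, a τ * w τ) / (∑ τ ∈ T, a τ * w τ) - (∑ τ ∈ S, b τ * w' τ) / (∑ τ ∈ T, b τ * w' τ)|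
      ≤ 2 * M ^ 2 * (ρ + W) + 2 * κ := by
  have h1 := abs_tilted_sub_tilted_le_tilt hM ha hZa hBad hW hwlo hwhi hwlo' hwhi' hκ hgood hS
  have h2 := abs_tilted_sub_tilted_le_base (w := w') hM ha hb hZa hZb hwlo' hwhi' hρ hS
  calc _ ≤ |(∑ τ ∈ S, a τ * w τ) / (∑ τ ∈ T, a τ * w τ) - (∑ τ ∈ S, a τ * w' τ) / (∑ τ ∈ T, a τ * w' τ)|
          + |(∑ τ ∈ S, a τ * w' τ) / (∑ τ ∈ T, a τ * w' τ) - (∑ τ ∈ S, b τ * w' τ) / (∑ τ ∈ T, b τ * w' τ)| := abs_sub_le _ _ _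
    _ ≤ (2 * κ + 2 * M ^ 2 * W) + 2 * M ^ 2 * ρ := add_le_add h1 h2
    _ = 2 * M ^ 2 * (ρ + W) + 2 * κ := by ring

end FiniteSums


end YMDAG.N14.ClassLawTiltTransfer

end
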